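import Summits.AtomisticToContinuum.FouriersLaw.Theses.BondHeatUncertainty
import Summits.AtomisticToContinuum.FouriersLaw.Theorems.BondHeatUncertaintyLinearResponseFTURSteadyHeatRatesHelper1

/-!
# Weak stationarity tested on polynomially bounded observables (helper 2 for `stub_steadyHeatRates`)

Helper file for crux `stmt-AtomisticToContinuum-9122` (`BondHeatUncertainty.LinearResponseFTUR`), line
`lebesgue-flip-duality`, stub `stub_steadyHeatRates`. A weak steady state `μ` of the pinned chain satisfies the
stationary Fokker–Planck equation `∫ L f dμ = 0` only for `f ∈ C_c^∞` (`OscillatorChain.IsSteadyState`). The steady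
heat rates need it for the (polynomial, non compactly supported) observables `p_i²/2`, `U(q_i)`, `V(q_{i+1} - q_i)`.
This file proves the extension ONCE:

* `pinnedChain_integral_generator_eq_zero_of_growth` (registered sub-goal) — if `μ` is finite, kills `L g` for every
  `g ∈ C_c^∞` and integrates every `(1 + H)^m`, then `∫ L f dμ = 0` for every smooth `f` with `f`, `L f`, `∂_{p_i} f`
  bounded by `C (1 + H)^k`: test on `f χ(H/R)` along `R = n + 1` (`generator_mul_cutoff`,
  `generator_comp_hamiltonian_closed`, `carreDuChamp_hamiltonian` of helper 1), `L(fχ_R) = Lf` on `{H < R}`,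
  `|L(fχ_R)| ≤ K (1 + H)^{k+1}` uniformly in `R ≥ 1`, dominated convergence.

Nothing here closes an item.
-/

noncomputable section

namespace Summit.AtomisticToContinuum.FouriersLaw.Theorems.LinearResponseFTUR

open MeasureTheory Filter Topology Set
open scoped ContDiff NNReal ENNReal
open Literature.MathematicalPhysics.KineticTheory
open Literature.MathematicalPhysics.KineticTheory.HeatConduction
open Summit.AtomisticToContinuum.FouriersLaw.Theorems.SubdiffusiveBondHeat

/-- **Weak stationarity for polynomially bounded observables** (registered sub-goal of `stub_steadyHeatRates`).
For the pinned chain (`ω₂ > 0`, `lam, β, γ ≥ 0`, `N ≥ 1`, `T_L, T_R ≥ 0`) and a finite measure `μ` with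
`∫ L g dμ = 0` for all `g ∈ C_c^∞` and `(1 + H)^m ∈ L¹(μ)` for all `m`: every smooth `f` with `|f|`, `|L f|`,
`|∂_{p_i} f| ≤ C (1 + H)^k` has `∫ L f dμ = 0`. Proof: test on `f χ(H/R)`, `R = n + 1`; by `generator_mul_cutoff`,
`generator_comp_hamiltonian_closed` and `carreDuChamp_hamiltonian`, `L(fχ_R) = Lf` on `{H < R}` and
`|L(fχ_R)| ≤ K (1 + H)^{k+1}` uniformly in `R ≥ 1`; dominated convergence. [folklore] -/
theorem pinnedChain_integral_generator_eq_zero_of_growth :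
    ∀ (ω₂ lam β γ : ℝ), 0 < ω₂ → 0 ≤ lam → 0 ≤ β → 0 ≤ γ → ∀ (N : ℕ), 0 < N →
    ∀ (T_L T_R : ℝ), 0 ≤ T_L → 0 ≤ T_R → ∀ (μ : Measure (PhaseSpace N)) [IsFiniteMeasure μ],
    (∀ g : PhaseSpace N → ℝ, ContDiff ℝ ((⊤ : ℕ∞) : WithTop ℕ∞) g → HasCompactSupport g →
      ∫ x, (pinnedChain ω₂ lam β γ).generator N T_L T_R g x ∂μ = 0) →
    (∀ m : ℕ, Integrable (fun x => (1 + (pinnedChain ω₂ lam β γ).hamiltonian N x) ^ m) μ) →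
    ∀ (f : PhaseSpace N → ℝ) (C : ℝ) (k : ℕ), ContDiff ℝ ((⊤ : ℕ∞) : WithTop ℕ∞) f →
    (∀ x, |f x| ≤ C * (1 + (pinnedChain ω₂ lam β γ).hamiltonian N x) ^ k) →
    (∀ x, |(pinnedChain ω₂ lam β γ).generator N T_L T_R f x| ≤
      C * (1 + (pinnedChain ω₂ lam β γ).hamiltonian N x) ^ k) →
    (∀ (i : Fin N) (x : PhaseSpace N),
      |partialP i f x| ≤ C * (1 + (pinnedChain ω₂ lam β γ).hamiltonian N x) ^ k) →
    ∫ x, (pinnedChain ω₂ lam β γ).generator N T_L T_R f x ∂μ = 0 := by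
  intro ω₂ lam β γ hω hl hβ hγ N hN T_L T_R hTL hTR μ _ hweak hmom f C k hf hfb hLb hPb
  have hN1 : N - 1 < N := Nat.sub_lt hN one_pos
  have hU : ContDiff ℝ ∞ (pinnedChain ω₂ lam β γ).U := pinnedChain_contDiff_U ω₂ lam β γ
  have hV : ContDiff ℝ ∞ (pinnedChain ω₂ lam β γ).V := pinnedChain_contDiff_V ω₂ lam β γ
  have hU1 : ContDiff ℝ 1 (pinnedChain ω₂ lam β γ).U := pinnedChain_contDiff_U ω₂ lam β γ
  have hV1 : ContDiff ℝ 1 (pinnedChain ω₂ lam β γ).V := pinnedChain_contDiff_V ω₂ lam β γ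
  have hHs : ContDiff ℝ ∞ ((pinnedChain ω₂ lam β γ).hamiltonian N) :=
    (pinnedChain ω₂ lam β γ).contDiff_hamiltonian hU hV N
  have hH2 : ContDiff ℝ 2 ((pinnedChain ω₂ lam β γ).hamiltonian N) := hHs.of_le (by norm_cast)
  have hHd : Differentiable ℝ ((pinnedChain ω₂ lam β γ).hamiltonian N) :=
    hH2.differentiable (by norm_num)
  have hf2 : ContDiff ℝ 2 f := hf.of_le (by norm_cast)
  have hfd : Differentiable ℝ f := hf2.differentiable (by norm_num)
  have hconf := pinnedChain_isConfining hω hl hβ hγ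
  have hH0 : ∀ x, 0 ≤ (pinnedChain ω₂ lam β γ).hamiltonian N x := fun x =>
    pinnedChain_hamiltonian_nonneg hω.le hl hβ γ N x
  have hPγ : (pinnedChain ω₂ lam β γ).γ = γ := rfl
  have hγL : 0 ≤ (pinnedChain ω₂ lam β γ).γ * T_L := by rw [hPγ]; positivity
  have hγR : 0 ≤ (pinnedChain ω₂ lam β γ).γ * T_R := by rw [hPγ]; positivity
  obtain ⟨M₁, hM₁0, hM₁⟩ := exists_bound_deriv_smoothCutoff
  obtain ⟨M₂, hM₂0, hM₂⟩ := exists_bound_deriv_deriv_smoothCutoff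
  have hC0 : 0 ≤ C := by
    have h1 := hfb 0
    have h2 : 0 < (1 + (pinnedChain ω₂ lam β γ).hamiltonian N 0) ^ k := by
      have := hH0 0; positivity
    rcases lt_or_ge C 0 with h | h
    · have := mul_neg_of_neg_of_pos h h2
      linarith [abs_nonneg (f 0)]
    · exact h
  -- elementary energy bounds on the momenta
  have hp2 : ∀ (x : PhaseSpace N) (i : Fin N), x.2 i ^ 2 ≤ 2 * (pinnedChain ω₂ lam β γ).hamiltonian N x := by
    intro x i
    have h1 := (pinnedChain ω₂ lam β γ).site_le_hamiltonian hconf.U_nonneg hconf.V_nonneg N x i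
    have h2 := hconf.U_nonneg (x.1 i)
    linarith
  have hp1 : ∀ (x : PhaseSpace N) (i : Fin N), |x.2 i| ≤ 1 + (pinnedChain ω₂ lam β γ).hamiltonian N x := by
    intro x i
    have h1 := abs_le_half_add_sq_half (x.2 i)
    have h2 := hp2 x i
    linarith
  -- the key pointwise formula for `L(f χ(H/R))`
  have key : ∀ (R : ℝ) (x : PhaseSpace N),
      (pinnedChain ω₂ lam β γ).generator N T_L T_R
          (fun y => f y * smoothCutoff ((pinnedChain ω₂ lam β γ).hamiltonian N y / R)) x =
        smoothCutoff ((pinnedChain ω₂ lam β γ).hamiltonian N x / R) *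
            (pinnedChain ω₂ lam β γ).generator N T_L T_R f x +
          f x * ((pinnedChain ω₂ lam β γ).γ *
            ((T_L * (deriv (deriv smoothCutoff) ((pinnedChain ω₂ lam β γ).hamiltonian N x / R) / R ^ 2 *
                  x.2 ⟨0, hN⟩ ^ 2 +
                deriv smoothCutoff ((pinnedChain ω₂ lam β γ).hamiltonian N x / R) / R) -
              deriv smoothCutoff ((pinnedChain ω₂ lam β γ).hamiltonian N x / R) / R * x.2 ⟨0, hN⟩ ^ 2) +
            (T_R * (deriv (deriv smoothCutoff) ((pinnedChain ω₂ lam β γ).hamiltonian N x / R) / R ^ 2 *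
                  x.2 ⟨N - 1, hN1⟩ ^ 2 +
                deriv smoothCutoff ((pinnedChain ω₂ lam β γ).hamiltonian N x / R) / R) -
              deriv smoothCutoff ((pinnedChain ω₂ lam β γ).hamiltonian N x / R) / R *
                x.2 ⟨N - 1, hN1⟩ ^ 2))) +
          deriv smoothCutoff ((pinnedChain ω₂ lam β γ).hamiltonian N x / R) / R *
            (Real.sqrt (2 * (pinnedChain ω₂ lam β γ).γ * T_L) ^ 2 * (x.2 ⟨0, hN⟩ * partialP ⟨0, hN⟩ f x) +
              Real.sqrt (2 * (pinnedChain ω₂ lam β γ).γ * T_R) ^ 2 *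
                (x.2 ⟨N - 1, hN1⟩ * partialP ⟨N - 1, hN1⟩ f x)) := by
    intro R x
    rw [generator_mul_cutoff _ hN hγL hγR hH2 hf2 R x,
      generator_comp_hamiltonian_closed _ hN hHd (hasDerivAt_scaled_smoothCutoff R)
        (hasDerivAt_deriv_scaled_smoothCutoff R) T_L T_R x,
      carreDuChamp_hamiltonian _ hN hHd hfd T_L T_R x]
  -- far from the cut-off the truncation is invisible
  have key_far : ∀ (R : ℝ) (x : PhaseSpace N), 0 < R → (pinnedChain ω₂ lam β γ).hamiltonian N x < R →
      (pinnedChain ω₂ lam β γ).generator N T_L T_R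
          (fun y => f y * smoothCutoff ((pinnedChain ω₂ lam β γ).hamiltonian N y / R)) x =
        (pinnedChain ω₂ lam β γ).generator N T_L T_R f x := by
    intro R x hR hx
    obtain ⟨h1, h2, h3⟩ := smoothCutoff_div_of_lt hR hx
    rw [key R x, h1, h2, h3]
    ring
  -- the uniform bound for `R ≥ 1`
  set K₁ : ℝ := γ * ((T_L + T_R) * (2 * M₂ + M₁) + 4 * M₁) with hK₁
  set G : ℝ := Real.sqrt (2 * (pinnedChain ω₂ lam β γ).γ * T_L) ^ 2 +
    Real.sqrt (2 * (pinnedChain ω₂ lam β γ).γ * T_R) ^ 2 with hG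
  set K : ℝ := C + C * K₁ + M₁ * G * C with hK
  have key_bd : ∀ (R : ℝ) (x : PhaseSpace N), 1 ≤ R →
      |(pinnedChain ω₂ lam β γ).generator N T_L T_R
          (fun y => f y * smoothCutoff ((pinnedChain ω₂ lam β γ).hamiltonian N y / R)) x| ≤
        K * ((1 + (pinnedChain ω₂ lam β γ).hamiltonian N x) ^ k *
          (1 + (pinnedChain ω₂ lam β γ).hamiltonian N x)) := by
    intro R x hR
    rw [key R x]
    have hR0 : 0 < R := by linarith
    have hh := hH0 x
    -- the cut-off factors
    have hF' : |deriv smoothCutoff ((pinnedChain ω₂ lam β γ).hamiltonian N x / R) / R| ≤ M₁ := by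
      rw [abs_div, abs_of_pos hR0]
      exact (div_le_self (abs_nonneg _) hR).trans (hM₁ _)
    have hF'' : |deriv (deriv smoothCutoff) ((pinnedChain ω₂ lam β γ).hamiltonian N x / R) / R ^ 2| ≤ M₂ := by
      rw [abs_div, abs_of_pos (by positivity : (0:ℝ) < R ^ 2)]
      exact (div_le_self (abs_nonneg _) (by nlinarith)).trans (hM₂ _)
    -- one bath term
    have hbath : ∀ (T : ℝ), 0 ≤ T → ∀ (p : ℝ), p ^ 2 ≤ 2 * (pinnedChain ω₂ lam β γ).hamiltonian N x →
        |T * (deriv (deriv smoothCutoff) ((pinnedChain ω₂ lam β γ).hamiltonian N x / R) / R ^ 2 * p ^ 2 +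
            deriv smoothCutoff ((pinnedChain ω₂ lam β γ).hamiltonian N x / R) / R) -
          deriv smoothCutoff ((pinnedChain ω₂ lam β γ).hamiltonian N x / R) / R * p ^ 2| ≤
          T * (M₂ * (2 * (pinnedChain ω₂ lam β γ).hamiltonian N x) + M₁) +
            M₁ * (2 * (pinnedChain ω₂ lam β γ).hamiltonian N x) := by
      intro T hT p hp
      set a := deriv (deriv smoothCutoff) ((pinnedChain ω₂ lam β γ).hamiltonian N x / R) / R ^ 2 with ha
      set b := deriv smoothCutoff ((pinnedChain ω₂ lam β γ).hamiltonian N x / R) / R with hb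
      have hp0 : 0 ≤ p ^ 2 := sq_nonneg p
      calc |T * (a * p ^ 2 + b) - b * p ^ 2| ≤ |T * (a * p ^ 2 + b)| + |b * p ^ 2| := abs_sub _ _
        _ = T * |a * p ^ 2 + b| + |b| * p ^ 2 := by
            rw [abs_mul, abs_mul, abs_of_nonneg hT, abs_of_nonneg hp0]
        _ ≤ T * (|a| * p ^ 2 + |b|) + |b| * p ^ 2 := by
            gcongr
            calc |a * p ^ 2 + b| ≤ |a * p ^ 2| + |b| := abs_add_le _ _
              _ = |a| * p ^ 2 + |b| := by rw [abs_mul, abs_of_nonneg hp0]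
        _ ≤ T * (M₂ * (2 * (pinnedChain ω₂ lam β γ).hamiltonian N x) + M₁) +
              M₁ * (2 * (pinnedChain ω₂ lam β γ).hamiltonian N x) := by
            gcongr
    have hmid : |(pinnedChain ω₂ lam β γ).γ *
        ((T_L * (deriv (deriv smoothCutoff) ((pinnedChain ω₂ lam β γ).hamiltonian N x / R) / R ^ 2 *
              x.2 ⟨0, hN⟩ ^ 2 +
            deriv smoothCutoff ((pinnedChain ω₂ lam β γ).hamiltonian N x / R) / R) -
          deriv smoothCutoff ((pinnedChain ω₂ lam β γ).hamiltonian N x / R) / R * x.2 ⟨0, hN⟩ ^ 2) +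
        (T_R * (deriv (deriv smoothCutoff) ((pinnedChain ω₂ lam β γ).hamiltonian N x / R) / R ^ 2 *
              x.2 ⟨N - 1, hN1⟩ ^ 2 +
            deriv smoothCutoff ((pinnedChain ω₂ lam β γ).hamiltonian N x / R) / R) -
          deriv smoothCutoff ((pinnedChain ω₂ lam β γ).hamiltonian N x / R) / R * x.2 ⟨N - 1, hN1⟩ ^ 2))| ≤
        K₁ * (1 + (pinnedChain ω₂ lam β γ).hamiltonian N x) := by
      have hA := hbath T_L hTL (x.2 ⟨0, hN⟩) (hp2 x _)
      have hB := hbath T_R hTR (x.2 ⟨N - 1, hN1⟩) (hp2 x _)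
      rw [abs_mul, hPγ, abs_of_nonneg hγ, hK₁]
      have hsum := (abs_add_le _ _).trans (add_le_add hA hB)
      have hT : 0 ≤ T_L + T_R := add_nonneg hTL hTR
      calc γ * _ ≤ γ * (T_L * (M₂ * (2 * (pinnedChain ω₂ lam β γ).hamiltonian N x) + M₁) +
            M₁ * (2 * (pinnedChain ω₂ lam β γ).hamiltonian N x) +
            (T_R * (M₂ * (2 * (pinnedChain ω₂ lam β γ).hamiltonian N x) + M₁) +
              M₁ * (2 * (pinnedChain ω₂ lam β γ).hamiltonian N x))) :=
            mul_le_mul_of_nonneg_left hsum hγ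
        _ ≤ γ * ((T_L + T_R) * (2 * M₂ + M₁) + 4 * M₁) * (1 + (pinnedChain ω₂ lam β γ).hamiltonian N x) := by
            have e1 : γ * (T_L * (M₂ * (2 * (pinnedChain ω₂ lam β γ).hamiltonian N x) + M₁) +
                M₁ * (2 * (pinnedChain ω₂ lam β γ).hamiltonian N x) +
                (T_R * (M₂ * (2 * (pinnedChain ω₂ lam β γ).hamiltonian N x) + M₁) +
                  M₁ * (2 * (pinnedChain ω₂ lam β γ).hamiltonian N x))) =
                γ * ((T_L + T_R) * (2 * M₂ * (pinnedChain ω₂ lam β γ).hamiltonian N x + M₁) +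
                  4 * M₁ * (pinnedChain ω₂ lam β γ).hamiltonian N x) := by ring
            rw [e1]
            have hXY : (T_L + T_R) * (2 * M₂ * (pinnedChain ω₂ lam β γ).hamiltonian N x + M₁) +
                4 * M₁ * (pinnedChain ω₂ lam β γ).hamiltonian N x ≤
                ((T_L + T_R) * (2 * M₂ + M₁) + 4 * M₁) * (1 + (pinnedChain ω₂ lam β γ).hamiltonian N x) := by
              nlinarith [mul_nonneg hT hM₂0, mul_nonneg (mul_nonneg hT hM₁0) hh, hM₁0, hh]
            calc γ * ((T_L + T_R) * (2 * M₂ * (pinnedChain ω₂ lam β γ).hamiltonian N x + M₁) +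
                  4 * M₁ * (pinnedChain ω₂ lam β γ).hamiltonian N x)
                ≤ γ * (((T_L + T_R) * (2 * M₂ + M₁) + 4 * M₁) *
                    (1 + (pinnedChain ω₂ lam β γ).hamiltonian N x)) := mul_le_mul_of_nonneg_left hXY hγ
              _ = _ := by ring
    have hΓ : |Real.sqrt (2 * (pinnedChain ω₂ lam β γ).γ * T_L) ^ 2 * (x.2 ⟨0, hN⟩ * partialP ⟨0, hN⟩ f x) +
          Real.sqrt (2 * (pinnedChain ω₂ lam β γ).γ * T_R) ^ 2 *
            (x.2 ⟨N - 1, hN1⟩ * partialP ⟨N - 1, hN1⟩ f x)| ≤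
        G * (C * (1 + (pinnedChain ω₂ lam β γ).hamiltonian N x) ^ k) *
          (1 + (pinnedChain ω₂ lam β γ).hamiltonian N x) := by
      have hone : ∀ (c : ℝ) (i : Fin N), |c ^ 2 * (x.2 i * partialP i f x)| ≤
          c ^ 2 * (C * (1 + (pinnedChain ω₂ lam β γ).hamiltonian N x) ^ k) *
            (1 + (pinnedChain ω₂ lam β γ).hamiltonian N x) := by
        intro c i
        rw [abs_mul, abs_mul, abs_of_nonneg (sq_nonneg c)]
        have h1 := hp1 x i
        have h2 := hPb i x
        calc c ^ 2 * (|x.2 i| * |partialP i f x|) ≤ c ^ 2 * ((1 + (pinnedChain ω₂ lam β γ).hamiltonian N x) *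
              (C * (1 + (pinnedChain ω₂ lam β γ).hamiltonian N x) ^ k)) := by
              refine mul_le_mul_of_nonneg_left ?_ (sq_nonneg c)
              exact mul_le_mul h1 h2 (abs_nonneg _) (by linarith)
          _ = _ := by ring
      refine (abs_add_le _ _).trans ((add_le_add (hone _ _) (hone _ _)).trans_eq ?_)
      rw [hG]; ring
    have := abs_three_terms_le (abs_smoothCutoff_le_one ((pinnedChain ω₂ lam β γ).hamiltonian N x / R))
      (hLb x) (hfb x) hmid hF' hΓ hC0 (by have := hh; positivity) hh
    rw [hK]
    exact this
  -- dominated convergence along `R = n + 1`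
  have hcont : ∀ n : ℕ, Continuous ((pinnedChain ω₂ lam β γ).generator N T_L T_R
      (fun y => f y * smoothCutoff ((pinnedChain ω₂ lam β γ).hamiltonian N y / ((n : ℝ) + 1)))) := by
    intro n
    refine (pinnedChain ω₂ lam β γ).continuous_generator hU1 hV1 N T_L T_R (hf2.mul ?_)
    exact (contDiff_smoothCutoff (n := 2)).comp (hH2.div_const _)
  have hsmooth : ∀ n : ℕ, ContDiff ℝ ∞
      (fun y => f y * smoothCutoff ((pinnedChain ω₂ lam β γ).hamiltonian N y / ((n : ℝ) + 1))) := fun n =>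
    hf.mul ((contDiff_smoothCutoff (n := ⊤)).comp (hHs.div_const _))
  have hsupp : ∀ n : ℕ, HasCompactSupport
      (fun y => f y * smoothCutoff ((pinnedChain ω₂ lam β γ).hamiltonian N y / ((n : ℝ) + 1))) := by
    intro n
    refine HasCompactSupport.intro
      (pinnedChain_isCompact_setOf_hamiltonian_le hω hl hβ γ N (2 * ((n : ℝ) + 1))) fun x hx => ?_
    have hx' : 2 ≤ (pinnedChain ω₂ lam β γ).hamiltonian N x / ((n : ℝ) + 1) := by
      rw [le_div_iff₀ (by positivity)]
      simp only [mem_setOf_eq, not_le] at hx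
      linarith
    simp [smoothCutoff_of_two_le hx']
  have hzero : ∀ n : ℕ, ∫ x, (pinnedChain ω₂ lam β γ).generator N T_L T_R
      (fun y => f y * smoothCutoff ((pinnedChain ω₂ lam β γ).hamiltonian N y / ((n : ℝ) + 1))) x ∂μ = 0 :=
    fun n => hweak _ (hsmooth n) (hsupp n)
  have hbound_int : Integrable (fun x => K * ((1 + (pinnedChain ω₂ lam β γ).hamiltonian N x) ^ k *
      (1 + (pinnedChain ω₂ lam β γ).hamiltonian N x))) μ := by
    have := (hmom (k + 1)).const_mul K
    refine this.congr (Eventually.of_forall fun x => ?_)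
    simp only [pow_succ]
  have hlim := tendsto_integral_of_dominated_convergence
    (fun x => K * ((1 + (pinnedChain ω₂ lam β γ).hamiltonian N x) ^ k *
      (1 + (pinnedChain ω₂ lam β γ).hamiltonian N x)))
    (fun n => (hcont n).aestronglyMeasurable) hbound_int
    (fun n => Eventually.of_forall fun x => by
      rw [Real.norm_eq_abs]
      exact key_bd _ x (by simp))
    (Eventually.of_forall fun x => by
      refine tendsto_const_nhds.congr' ?_
      refine Filter.eventually_atTop.2 ⟨⌈(pinnedChain ω₂ lam β γ).hamiltonian N x⌉₊, fun n hn => ?_⟩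
      refine (key_far _ x (by positivity) ?_).symm
      have h1 := Nat.le_ceil ((pinnedChain ω₂ lam β γ).hamiltonian N x)
      have h2 : (⌈(pinnedChain ω₂ lam β γ).hamiltonian N x⌉₊ : ℝ) ≤ n := by exact_mod_cast hn
      linarith)
  simp only [hzero] at hlim
  exact (tendsto_nhds_unique hlim tendsto_const_nhds).symm ▸ rfl

end Summit.AtomisticToContinuum.FouriersLaw.Theorems.LinearResponseFTUR

end
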